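import Mathlib

/-!
# Star peeling in a fixed admissible order can fail (six sets on eight points)

Helper file for crux `stmt-CriticalPhenomena-4575` (`NoHeavyLowerTail`, route `PercNearOneGluingNoHeavy`),
new-inequality factory seat `prim-ineq-gen-3` (gen 26).  Everything here is PROVED; no definitions.

Pencil row of a set `C`: `E ↦ [E ⊆ C] + t [E ∩ C = ∅]`.  CONJECTURE ORD (memo `run/shared/lean/prim/prim-ineq-gen-3/CONJECTURE-ORD.md`)
asserts that for an admissible order `A_0, …, A_{m-1}` the rows restricted to the columns `T_ord = {∅} ∪ {A_i \ A_j : i < j}` are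
independent for `t ∉ {±1}`.  The natural inductive route ('STAR peeling', memo `CONJECTURE-STAR.md` §3) would show that SOME member `A_k`
is isolated by the `T_ord`-columns THROUGH it (`∅`, `A_i \ A_k` for `i < k`, `A_k \ A_j` for `j > k`), peel it, and recurse; it resolved
every hard family met before (hundreds of thousands of (family, order, t) triples).  It is FALSE as a universal statement: for the antichain
`A = (0146, 123, 035, 02, 056, 0467)` on eight points, in THIS order and at `t² = t + 1`, every one of the six stars has a non-zero
annihilating functional with non-zero `k`-th coordinate (below, one explicit functional per member, valid over every field), so no member
can be peeled first — while the full `T_ord`-pencil of this order has rank `6` at these `t` (exact computation; ORD holds) and the other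
`719` orders of the same family are star-peelable.  Found by kit job j232510 (31 such (antichain, order) pairs among `1.2·10⁸` random
ones, all with ORD intact); memo `FINDINGS-gen26.md` F26-11.
* `starOrdCex_antichain`, `starOrdCex_sdiff` — the family is an antichain; its fifteen ordered differences;
* `starOrdCex_star_k` (`k = 0, …, 5`) — the functional `c^k` kills `κ_∅` and every `T_ord`-column through `A_k`;
* `starOrdCex_diag_ne_zero` — the diagonal coordinates `c^k_k = t, -t, -1, t-2, 1-t, 1` are non-zero whenever `t² = t + 1`.
(prim-ineq-gen-3 gen 26, 2026-08-25.)
-/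

namespace Summit.CriticalPhenomena.PercolationContinuityZ3.Theorems

namespace OrderedDifferences

open Finset

/-- The six sets `(0146, 123, 035, 02, 056, 0467)` are pairwise incomparable (so every order of them is admissible). -/
theorem starOrdCex_antichain :
    ∀ i j : Fin 6, i ≠ j → ¬ (![{0, 1, 4, 6}, {1, 2, 3}, {0, 3, 5}, {0, 2}, {0, 5, 6}, {0, 4, 6, 7}] : Fin 6 → Finset (Fin 8)) i ⊆ (![{0, 1, 4, 6}, {1, 2, 3}, {0, 3, 5}, {0, 2}, {0, 5, 6}, {0, 4, 6, 7}] : Fin 6 → Finset (Fin 8)) j := by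
  decide

/-- The fifteen `T_ord`-columns `A_i \\ A_j` (`i < j`) of the order `(0146, 123, 035, 02, 056, 0467)`. -/
theorem starOrdCex_sdiff :
    (({0, 1, 4, 6} : Finset (Fin 8)) \ {1, 2, 3} = {0, 4, 6}) ∧
    (({0, 1, 4, 6} : Finset (Fin 8)) \ {0, 3, 5} = {1, 4, 6}) ∧
    (({0, 1, 4, 6} : Finset (Fin 8)) \ {0, 2} = {1, 4, 6}) ∧
    (({0, 1, 4, 6} : Finset (Fin 8)) \ {0, 5, 6} = {1, 4}) ∧
    (({0, 1, 4, 6} : Finset (Fin 8)) \ {0, 4, 6, 7} = {1}) ∧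
    (({1, 2, 3} : Finset (Fin 8)) \ {0, 3, 5} = {1, 2}) ∧
    (({1, 2, 3} : Finset (Fin 8)) \ {0, 2} = {1, 3}) ∧
    (({1, 2, 3} : Finset (Fin 8)) \ {0, 5, 6} = {1, 2, 3}) ∧
    (({1, 2, 3} : Finset (Fin 8)) \ {0, 4, 6, 7} = {1, 2, 3}) ∧
    (({0, 3, 5} : Finset (Fin 8)) \ {0, 2} = {3, 5}) ∧
    (({0, 3, 5} : Finset (Fin 8)) \ {0, 5, 6} = {3}) ∧
    (({0, 3, 5} : Finset (Fin 8)) \ {0, 4, 6, 7} = {3, 5}) ∧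
    (({0, 2} : Finset (Fin 8)) \ {0, 5, 6} = {2}) ∧
    (({0, 2} : Finset (Fin 8)) \ {0, 4, 6, 7} = {2}) ∧
    (({0, 5, 6} : Finset (Fin 8)) \ {0, 4, 6, 7} = {5}) := by
  decide

/-- Member `k = 0` (`A_0 = {0, 1, 4, 6}`): the functional `c^0 = (t, -t, -1, 0, 0, 1)` kills `κ_∅` and the `T_ord`-columns through `A_0`
(`{0, 4, 6}, {1, 4, 6}, {1, 4}, {1}`) whenever `t² = t + 1`; its `k`-th coordinate is `t`. -/
theorem starOrdCex_star_0 {K : Type*} [Field K] (t : K) (ht : t ^ 2 = t + 1) :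
    ∀ E ∈ ({∅, {0, 4, 6}, {1, 4, 6}, {1, 4}, {1}} : Finset (Finset (Fin 8))),
      ∑ i : Fin 6, (![(t : K), (-t : K), (-1 : K), (0 : K), (0 : K), (1 : K)] i) *
        ((if E ⊆ (![{0, 1, 4, 6}, {1, 2, 3}, {0, 3, 5}, {0, 2}, {0, 5, 6}, {0, 4, 6, 7}] : Fin 6 → Finset (Fin 8)) i then (1 : K) else 0) + t * (if Disjoint E ((![{0, 1, 4, 6}, {1, 2, 3}, {0, 3, 5}, {0, 2}, {0, 5, 6}, {0, 4, 6, 7}] : Fin 6 → Finset (Fin 8)) i) then (1 : K) else 0)) = 0 := by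
  intro E hE
  simp only [mem_insert, mem_singleton] at hE
  rcases hE with rfl | rfl | rfl | rfl | rfl
  · simp (config := { decide := true }) only [Fin.sum_univ_succ, Fin.sum_univ_zero, Matrix.cons_val_zero, Matrix.cons_val_succ, if_true]
    linear_combination (0 : K) * ht
  · simp (config := { decide := true }) only [Fin.sum_univ_succ, Fin.sum_univ_zero, Matrix.cons_val_zero, Matrix.cons_val_succ, if_true, if_false]
    linear_combination (-1 : K) * ht
  · simp (config := { decide := true }) only [Fin.sum_univ_succ, Fin.sum_univ_zero, Matrix.cons_val_zero, Matrix.cons_val_succ, if_true, if_false]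
    linear_combination (0 : K) * ht
  · simp (config := { decide := true }) only [Fin.sum_univ_succ, Fin.sum_univ_zero, Matrix.cons_val_zero, Matrix.cons_val_succ, if_true, if_false]
    linear_combination (0 : K) * ht
  · simp (config := { decide := true }) only [Fin.sum_univ_succ, Fin.sum_univ_zero, Matrix.cons_val_zero, Matrix.cons_val_succ, if_true, if_false]
    linear_combination (0 : K) * ht

/-- Member `k = 1` (`A_1 = {1, 2, 3}`): the functional `c^1 = (-1+1t, -t, 0, 0, -1, 2)` kills `κ_∅` and the `T_ord`-columns through `A_1`
(`{0, 4, 6}, {1, 2}, {1, 3}, {1, 2, 3}`) whenever `t² = t + 1`; its `k`-th coordinate is `-t`. -/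
theorem starOrdCex_star_1 {K : Type*} [Field K] (t : K) (ht : t ^ 2 = t + 1) :
    ∀ E ∈ ({∅, {0, 4, 6}, {1, 2}, {1, 3}, {1, 2, 3}} : Finset (Finset (Fin 8))),
      ∑ i : Fin 6, (![(-1 + t : K), (-t : K), (0 : K), (0 : K), (-1 : K), (2 : K)] i) *
        ((if E ⊆ (![{0, 1, 4, 6}, {1, 2, 3}, {0, 3, 5}, {0, 2}, {0, 5, 6}, {0, 4, 6, 7}] : Fin 6 → Finset (Fin 8)) i then (1 : K) else 0) + t * (if Disjoint E ((![{0, 1, 4, 6}, {1, 2, 3}, {0, 3, 5}, {0, 2}, {0, 5, 6}, {0, 4, 6, 7}] : Fin 6 → Finset (Fin 8)) i) then (1 : K) else 0)) = 0 := by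
  intro E hE
  simp only [mem_insert, mem_singleton] at hE
  rcases hE with rfl | rfl | rfl | rfl | rfl
  · simp (config := { decide := true }) only [Fin.sum_univ_succ, Fin.sum_univ_zero, Matrix.cons_val_zero, Matrix.cons_val_succ, if_true]
    linear_combination (0 : K) * ht
  · simp (config := { decide := true }) only [Fin.sum_univ_succ, Fin.sum_univ_zero, Matrix.cons_val_zero, Matrix.cons_val_succ, if_true, if_false]
    linear_combination (-1 : K) * ht
  · simp (config := { decide := true }) only [Fin.sum_univ_succ, Fin.sum_univ_zero, Matrix.cons_val_zero, Matrix.cons_val_succ, if_true, if_false]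
    linear_combination (0 : K) * ht
  · simp (config := { decide := true }) only [Fin.sum_univ_succ, Fin.sum_univ_zero, Matrix.cons_val_zero, Matrix.cons_val_succ, if_true, if_false]
    linear_combination (0 : K) * ht
  · simp (config := { decide := true }) only [Fin.sum_univ_succ, Fin.sum_univ_zero, Matrix.cons_val_zero, Matrix.cons_val_succ, if_true, if_false]
    linear_combination (0 : K) * ht

/-- Member `k = 2` (`A_2 = {0, 3, 5}`): the functional `c^2 = (-2-1t, 1, -1, 2t, 1-1t, 1)` kills `κ_∅` and the `T_ord`-columns through `A_2`
(`{1, 4, 6}, {1, 2}, {3, 5}, {3}`) whenever `t² = t + 1`; its `k`-th coordinate is `-1`. -/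
theorem starOrdCex_star_2 {K : Type*} [Field K] (t : K) (ht : t ^ 2 = t + 1) :
    ∀ E ∈ ({∅, {1, 4, 6}, {1, 2}, {3, 5}, {3}} : Finset (Finset (Fin 8))),
      ∑ i : Fin 6, (![(-2 - t : K), (1 : K), (-1 : K), (2 * t : K), (1 - t : K), (1 : K)] i) *
        ((if E ⊆ (![{0, 1, 4, 6}, {1, 2, 3}, {0, 3, 5}, {0, 2}, {0, 5, 6}, {0, 4, 6, 7}] : Fin 6 → Finset (Fin 8)) i then (1 : K) else 0) + t * (if Disjoint E ((![{0, 1, 4, 6}, {1, 2, 3}, {0, 3, 5}, {0, 2}, {0, 5, 6}, {0, 4, 6, 7}] : Fin 6 → Finset (Fin 8)) i) then (1 : K) else 0)) = 0 := by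
  intro E hE
  simp only [mem_insert, mem_singleton] at hE
  rcases hE with rfl | rfl | rfl | rfl | rfl
  · simp (config := { decide := true }) only [Fin.sum_univ_succ, Fin.sum_univ_zero, Matrix.cons_val_zero, Matrix.cons_val_succ, if_true]
    linear_combination (0 : K) * ht
  · simp (config := { decide := true }) only [Fin.sum_univ_succ, Fin.sum_univ_zero, Matrix.cons_val_zero, Matrix.cons_val_succ, if_true, if_false]
    linear_combination (2 : K) * ht
  · simp (config := { decide := true }) only [Fin.sum_univ_succ, Fin.sum_univ_zero, Matrix.cons_val_zero, Matrix.cons_val_succ, if_true, if_false]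
    linear_combination (-1 : K) * ht
  · simp (config := { decide := true }) only [Fin.sum_univ_succ, Fin.sum_univ_zero, Matrix.cons_val_zero, Matrix.cons_val_succ, if_true, if_false]
    linear_combination (1 : K) * ht
  · simp (config := { decide := true }) only [Fin.sum_univ_succ, Fin.sum_univ_zero, Matrix.cons_val_zero, Matrix.cons_val_succ, if_true, if_false]
    linear_combination (0 : K) * ht

/-- Member `k = 3` (`A_3 = {0, 2}`): the functional `c^3 = (-3+1t, 2-1t, -2+2t, -2+1t, 4-3t, 1)` kills `κ_∅` and the `T_ord`-columns through `A_3`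
(`{1, 4, 6}, {1, 3}, {3, 5}, {2}`) whenever `t² = t + 1`; its `k`-th coordinate is `t - 2`. -/
theorem starOrdCex_star_3 {K : Type*} [Field K] (t : K) (ht : t ^ 2 = t + 1) :
    ∀ E ∈ ({∅, {1, 4, 6}, {1, 3}, {3, 5}, {2}} : Finset (Finset (Fin 8))),
      ∑ i : Fin 6, (![(-3 + t : K), (2 - t : K), (-2 +2 * t : K), (-2 + t : K), (4 -3 * t : K), (1 : K)] i) *
        ((if E ⊆ (![{0, 1, 4, 6}, {1, 2, 3}, {0, 3, 5}, {0, 2}, {0, 5, 6}, {0, 4, 6, 7}] : Fin 6 → Finset (Fin 8)) i then (1 : K) else 0) + t * (if Disjoint E ((![{0, 1, 4, 6}, {1, 2, 3}, {0, 3, 5}, {0, 2}, {0, 5, 6}, {0, 4, 6, 7}] : Fin 6 → Finset (Fin 8)) i) then (1 : K) else 0)) = 0 := by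
  intro E hE
  simp only [mem_insert, mem_singleton] at hE
  rcases hE with rfl | rfl | rfl | rfl | rfl
  · simp (config := { decide := true }) only [Fin.sum_univ_succ, Fin.sum_univ_zero, Matrix.cons_val_zero, Matrix.cons_val_succ, if_true]
    linear_combination (0 : K) * ht
  · simp (config := { decide := true }) only [Fin.sum_univ_succ, Fin.sum_univ_zero, Matrix.cons_val_zero, Matrix.cons_val_succ, if_true, if_false]
    linear_combination (3 : K) * ht
  · simp (config := { decide := true }) only [Fin.sum_univ_succ, Fin.sum_univ_zero, Matrix.cons_val_zero, Matrix.cons_val_succ, if_true, if_false]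
    linear_combination (-2 : K) * ht
  · simp (config := { decide := true }) only [Fin.sum_univ_succ, Fin.sum_univ_zero, Matrix.cons_val_zero, Matrix.cons_val_succ, if_true, if_false]
    linear_combination (2 : K) * ht
  · simp (config := { decide := true }) only [Fin.sum_univ_succ, Fin.sum_univ_zero, Matrix.cons_val_zero, Matrix.cons_val_succ, if_true, if_false]
    linear_combination (0 : K) * ht

/-- Member `k = 4` (`A_4 = {0, 5, 6}`): the functional `c^4 = (-1, 1-1t, -1+1t, -1+1t, 1-1t, 1)` kills `κ_∅` and the `T_ord`-columns through `A_4`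
(`{1, 4}, {1, 2, 3}, {3}, {2}, {5}`) whenever `t² = t + 1`; its `k`-th coordinate is `1 - t`. -/
theorem starOrdCex_star_4 {K : Type*} [Field K] (t : K) (ht : t ^ 2 = t + 1) :
    ∀ E ∈ ({∅, {1, 4}, {1, 2, 3}, {3}, {2}, {5}} : Finset (Finset (Fin 8))),
      ∑ i : Fin 6, (![(-1 : K), (1 - t : K), (-1 + t : K), (-1 + t : K), (1 - t : K), (1 : K)] i) *
        ((if E ⊆ (![{0, 1, 4, 6}, {1, 2, 3}, {0, 3, 5}, {0, 2}, {0, 5, 6}, {0, 4, 6, 7}] : Fin 6 → Finset (Fin 8)) i then (1 : K) else 0) + t * (if Disjoint E ((![{0, 1, 4, 6}, {1, 2, 3}, {0, 3, 5}, {0, 2}, {0, 5, 6}, {0, 4, 6, 7}] : Fin 6 → Finset (Fin 8)) i) then (1 : K) else 0)) = 0 := by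
  intro E hE
  simp only [mem_insert, mem_singleton] at hE
  rcases hE with rfl | rfl | rfl | rfl | rfl | rfl
  · simp (config := { decide := true }) only [Fin.sum_univ_succ, Fin.sum_univ_zero, Matrix.cons_val_zero, Matrix.cons_val_succ, if_true]
    linear_combination (0 : K) * ht
  · simp (config := { decide := true }) only [Fin.sum_univ_succ, Fin.sum_univ_zero, Matrix.cons_val_zero, Matrix.cons_val_succ, if_true, if_false]
    linear_combination (1 : K) * ht
  · simp (config := { decide := true }) only [Fin.sum_univ_succ, Fin.sum_univ_zero, Matrix.cons_val_zero, Matrix.cons_val_succ, if_true, if_false]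
    linear_combination (-1 : K) * ht
  · simp (config := { decide := true }) only [Fin.sum_univ_succ, Fin.sum_univ_zero, Matrix.cons_val_zero, Matrix.cons_val_succ, if_true, if_false]
    linear_combination (0 : K) * ht
  · simp (config := { decide := true }) only [Fin.sum_univ_succ, Fin.sum_univ_zero, Matrix.cons_val_zero, Matrix.cons_val_succ, if_true, if_false]
    linear_combination (0 : K) * ht
  · simp (config := { decide := true }) only [Fin.sum_univ_succ, Fin.sum_univ_zero, Matrix.cons_val_zero, Matrix.cons_val_succ, if_true, if_false]
    linear_combination (0 : K) * ht

/-- Member `k = 5` (`A_5 = {0, 4, 6, 7}`): the functional `c^5 = (-1, 1, t, -1, -t, 1)` kills `κ_∅` and the `T_ord`-columns through `A_5`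
(`{1}, {1, 2, 3}, {3, 5}, {2}, {5}`) whenever `t² = t + 1`; its `k`-th coordinate is `1`. -/
theorem starOrdCex_star_5 {K : Type*} [Field K] (t : K) (ht : t ^ 2 = t + 1) :
    ∀ E ∈ ({∅, {1}, {1, 2, 3}, {3, 5}, {2}, {5}} : Finset (Finset (Fin 8))),
      ∑ i : Fin 6, (![(-1 : K), (1 : K), (t : K), (-1 : K), (-t : K), (1 : K)] i) *
        ((if E ⊆ (![{0, 1, 4, 6}, {1, 2, 3}, {0, 3, 5}, {0, 2}, {0, 5, 6}, {0, 4, 6, 7}] : Fin 6 → Finset (Fin 8)) i then (1 : K) else 0) + t * (if Disjoint E ((![{0, 1, 4, 6}, {1, 2, 3}, {0, 3, 5}, {0, 2}, {0, 5, 6}, {0, 4, 6, 7}] : Fin 6 → Finset (Fin 8)) i) then (1 : K) else 0)) = 0 := by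
  intro E hE
  simp only [mem_insert, mem_singleton] at hE
  rcases hE with rfl | rfl | rfl | rfl | rfl | rfl
  · simp (config := { decide := true }) only [Fin.sum_univ_succ, Fin.sum_univ_zero, Matrix.cons_val_zero, Matrix.cons_val_succ, if_true]
    linear_combination (0 : K) * ht
  · simp (config := { decide := true }) only [Fin.sum_univ_succ, Fin.sum_univ_zero, Matrix.cons_val_zero, Matrix.cons_val_succ, if_true, if_false]
    linear_combination (0 : K) * ht
  · simp (config := { decide := true }) only [Fin.sum_univ_succ, Fin.sum_univ_zero, Matrix.cons_val_zero, Matrix.cons_val_succ, if_true, if_false]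
    linear_combination (-1 : K) * ht
  · simp (config := { decide := true }) only [Fin.sum_univ_succ, Fin.sum_univ_zero, Matrix.cons_val_zero, Matrix.cons_val_succ, if_true, if_false]
    linear_combination (0 : K) * ht
  · simp (config := { decide := true }) only [Fin.sum_univ_succ, Fin.sum_univ_zero, Matrix.cons_val_zero, Matrix.cons_val_succ, if_true, if_false]
    linear_combination (0 : K) * ht
  · simp (config := { decide := true }) only [Fin.sum_univ_succ, Fin.sum_univ_zero, Matrix.cons_val_zero, Matrix.cons_val_succ, if_true, if_false]
    linear_combination (0 : K) * ht

/-- The diagonal coordinates `c^k_k` (`t, -t, -1, t-2, 1-t, 1`) are all non-zero over any field in which `t² = t + 1`; hence at such `t`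
no member of the order `(0146, 123, 035, 02, 056, 0467)` is isolated by the `T_ord`-columns through it. -/
theorem starOrdCex_diag_ne_zero {K : Type*} [Field K] (t : K) (ht : t ^ 2 = t + 1) :
    (t : K) ≠ 0 ∧ (-t : K) ≠ 0 ∧ (-1 : K) ≠ 0 ∧ (t - 2 : K) ≠ 0 ∧ (1 - t : K) ≠ 0 ∧ (1 : K) ≠ 0 := by
  refine ⟨?_, ?_, by norm_num, ?_, ?_, one_ne_zero⟩
  · rintro rfl
    exact one_ne_zero (by linear_combination -ht : (1 : K) = 0)
  · intro h
    have h0 : t = 0 := neg_eq_zero.mp h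
    subst h0
    exact one_ne_zero (by linear_combination -ht : (1 : K) = 0)
  · intro h
    have h2 : t = 2 := sub_eq_zero.mp h
    subst h2
    exact one_ne_zero (by linear_combination ht : (1 : K) = 0)
  · intro h
    have h1 : t = 1 := (sub_eq_zero.mp h).symm
    subst h1
    exact one_ne_zero (by linear_combination -ht : (1 : K) = 0)

end OrderedDifferences

end Summit.CriticalPhenomena.PercolationContinuityZ3.Theorems
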